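import Mathlib
import HarnessLib
import Summits.HubbardSuperconductivity.HubbardSuperconductivity.Theorems.KLProgrammeC4aJacobianPolarJetsFourJac
import Summits.HubbardSuperconductivity.HubbardSuperconductivity.Theorems.KLProgrammeC4aJacobianFrameJetsThree
import Summits.HubbardSuperconductivity.HubbardSuperconductivity.Theorems.KLProgrammeKLRegimeSplitTwoLegSizesMSDiffProfileSizes

/-!
# Route `KLProgramme` — crux C4a, named input (i) «Jacobian jets» AT THE FRAME, ORDER 4 with an explicit constant
# `‖∂_ϑ⁴ levelChartJac μ K (ρ, ·)‖ ≤ klJacG4 Dt_min A A₃ A₄ A₅` — affine in the frame's order-5 size `A₅`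

Cell `gate-hubbard-kl`, lane hubbard-kl-c4a-1 (g2); helper for stub (C) of `KLRegimeEngineV17F2` (stmt-HubbardSuperconductivity-20437; memo
HOME/hubbard-kl-c4a-1/C4A-PLAN.md §13; plan g17 KL STATUS l.3124 (1)).  The order-4 companion of `…C4aJacobianFrameJets` (orders 0–2) and
`…FrameJetsThree` (order 3): feeds `…C4aJacobianPolarJetsFourJac.abs_deriv_four_polarJac_le` the frame's sizes (`E₁ = 4+2A`, `E₂ = 4+4A`,
`E₃ = 4+8A₃`, `E₄ = 4+16A₄`, `E₅ = 4+32A₅` (`norm_fderiv_five_pertBand_le`, from a single-order size `A₅` of `D⁵(frameShift K)`),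
`ρ₀ = Dt_min − 2A`, `U₀ = π√2`, `R₁, R₂, R₃` of the earlier files, `R₄` from `abs_deriv_four_le_of_isRoot`).

* `norm_fderiv_five_frameShift_le` (`32A₅`), `norm_fderiv_five_pertBand_le` (`4 + 32A₅`);
* `klJacR4`, `klJacΔ4`, `klJacG4`, `klJacGTable4` (explicit constants); `abs_deriv_four_levelChartJac_le`;
* `norm_iteratedDeriv_levelChartJac_le_four` — the `hJjet` shape of `norm_iteratedDeriv_tubeTadpole_le` at `N = 4` (the engine's jet order).

Pure calculus on the tree's objects; nothing is asserted about the Hubbard model.  References: BGM 2006 §2.4 Lemma 2.1 (2.40)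
[cite: BenfattoGiulianiMastropietro2006].
-/

noncomputable section

namespace Summit.HubbardSuperconductivity.HubbardSuperconductivity.Theorems.C4a

set_option linter.dupNamespace false -- summit = problem name (single-conjunct summit), D-0017
set_option maxSynthPendingDepth 5 -- nested operator-norm instances (fifth Fréchet derivatives)

open Real Set
open Literature.MathematicalPhysics.QuantumLattice Literature.MathematicalPhysics.QuantumLattice.BandSectorCounting
open Summit.HubbardSuperconductivity.HubbardSuperconductivity.Theorems.DispersionFlow
open Summit.HubbardSuperconductivity.HubbardSuperconductivity.Theorems.KLRegimeSplit
open Summit.HubbardSuperconductivity.HubbardSuperconductivity.Theorems.PerturbedFermiCurve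

/-! ## §1 The order-5 size of the perturbed band at the frame -/

/-- Order 5, nested form: `‖D⁵δ_K(k)‖ ≤ 32A₅` from a single-order size of `D⁵(frameShift K)` (`‖toLp‖ ≤ 2`). -/
theorem norm_fderiv_five_frameShift_le {K : TrigPolyC4v} {A₅ : ℝ}
    (hA₅ : ∀ p : Momentum, ‖iteratedFDeriv ℝ 5 (frameShift K) p‖ ≤ A₅) (k : Fin 2 → ℝ) :
    ‖fderiv ℝ (fderiv ℝ (fderiv ℝ (fderiv ℝ (fderiv ℝ (fun p : Fin 2 → ℝ => -K.eval p))))) k‖ ≤ 32 * A₅ := by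
  rw [norm_fderiv_five_eq_norm_iteratedFDeriv, ← frameShift_toLp_eq_neg_eval]
  have h := norm_iteratedFDeriv_frameShift_toLp_le_single hA₅ k
  linarith

/-- `‖D⁵(ε₀ + δ_K)(x)‖ ≤ 4 + 32A₅` everywhere (`‖D⁵ε₀‖ ≤ 4`, `norm_iteratedFDeriv_sqDispersion_le`). -/
theorem norm_fderiv_five_pertBand_le {K : TrigPolyC4v} {A₅ : ℝ}
    (hA₅ : ∀ p : Momentum, ‖iteratedFDeriv ℝ 5 (frameShift K) p‖ ≤ A₅) (x : Fin 2 → ℝ) :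
    ‖fderiv ℝ (fderiv ℝ (fderiv ℝ (fderiv ℝ (fderiv ℝ (fun k : Fin 2 → ℝ => sqDispersion k + (fun k : Fin 2 → ℝ => -K.eval k) k))))) x‖ ≤
      4 + 32 * A₅ := by
  rw [norm_fderiv_five_eq_norm_iteratedFDeriv,
    show (fun k : Fin 2 → ℝ => sqDispersion k + (fun k : Fin 2 → ℝ => -K.eval k) k) = sqDispersion + fun k => -K.eval k from rfl,
    iteratedFDeriv_add_apply contDiff_sqDispersion.contDiffAt
      (by rw [← frameShift_toLp_eq_neg_eval]; exact (contDiff_frameShift_toLp K).contDiffAt)]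
  refine (norm_add_le _ _).trans (add_le_add (norm_iteratedFDeriv_sqDispersion_le 5 _) ?_)
  rw [← norm_fderiv_five_eq_norm_iteratedFDeriv]
  exact norm_fderiv_five_frameShift_le hA₅ x

/-! ## §2 The explicit order-4 constants -/

/-- `R₄(A, A₃, A₄)` — the uniform fourth-derivative bound of the frame's radius (`abs_deriv_four_le_of_isRoot` at `R₁,R₂,R₃ = klJacR1,2,3`,
`κ₁ = 2A`, `κ₂ = 4A`, `κ₃ = 8A₃`, `κ₄ = 16A₄`). -/
def klJacR4 (Dt A A₃ A₄ : ℝ) : ℝ :=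
  ((4 + 16 * A₄) * (klJacR1 Dt A + π * Real.sqrt 2) ^ 4 +
      6 * (4 + 8 * A₃) * (klJacR1 Dt A + π * Real.sqrt 2) ^ 2 * (klJacR2 Dt A + 2 * klJacR1 Dt A + π * Real.sqrt 2) +
      3 * (4 + 4 * A) * (klJacR2 Dt A + 2 * klJacR1 Dt A + π * Real.sqrt 2) ^ 2 +
      4 * (4 + 4 * A) * (klJacR1 Dt A + π * Real.sqrt 2) * (klJacR3 Dt A A₃ + 3 * klJacR2 Dt A + 3 * klJacR1 Dt A + π * Real.sqrt 2) +
      (4 + 2 * A) * (4 * klJacR3 Dt A A₃ + 6 * klJacR2 Dt A + 4 * klJacR1 Dt A + π * Real.sqrt 2)) / (Dt - 2 * A)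

/-- `Δ₄` (the polynomial of `abs_radialSlope_deriv_four_le`) at the frame's sizes (`E₅ = 4 + 32A₅`). -/
def klJacΔ4 (Dt A A₃ A₄ A₅ : ℝ) : ℝ :=
  (4 + 2 * A) + 4 * (4 + 4 * A) * (klJacR1 Dt A + π * Real.sqrt 2) + 6 * (4 + 4 * A) * (klJacR2 Dt A + 2 * klJacR1 Dt A + π * Real.sqrt 2) +
    4 * (4 + 4 * A) * (klJacR3 Dt A A₃ + 3 * klJacR2 Dt A + 3 * klJacR1 Dt A + π * Real.sqrt 2) +
    (4 + 4 * A) * (klJacR4 Dt A A₃ A₄ + 6 * klJacR2 Dt A + π * Real.sqrt 2 + (4 * klJacR3 Dt A A₃ + 4 * klJacR1 Dt A)) +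
    6 * (4 + 8 * A₃) * (klJacR1 Dt A + π * Real.sqrt 2) * (klJacR1 Dt A + π * Real.sqrt 2) +
    12 * (4 + 8 * A₃) * (klJacR1 Dt A + π * Real.sqrt 2) * (klJacR2 Dt A + 2 * klJacR1 Dt A + π * Real.sqrt 2) +
    4 * (4 + 8 * A₃) * (klJacR1 Dt A + π * Real.sqrt 2) * (klJacR3 Dt A A₃ + 3 * klJacR2 Dt A + 3 * klJacR1 Dt A + π * Real.sqrt 2) +
    3 * (4 + 8 * A₃) * (klJacR2 Dt A + 2 * klJacR1 Dt A + π * Real.sqrt 2) * (klJacR2 Dt A + 2 * klJacR1 Dt A + π * Real.sqrt 2) +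
    4 * (4 + 16 * A₄) * (klJacR1 Dt A + π * Real.sqrt 2) * (klJacR1 Dt A + π * Real.sqrt 2) * (klJacR1 Dt A + π * Real.sqrt 2) +
    6 * (4 + 16 * A₄) * (klJacR1 Dt A + π * Real.sqrt 2) * (klJacR1 Dt A + π * Real.sqrt 2) * (klJacR2 Dt A + 2 * klJacR1 Dt A + π * Real.sqrt 2) +
    (4 + 32 * A₅) * (klJacR1 Dt A + π * Real.sqrt 2) * (klJacR1 Dt A + π * Real.sqrt 2) * (klJacR1 Dt A + π * Real.sqrt 2) * (klJacR1 Dt A + π * Real.sqrt 2)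

/-- **The order-4 Jacobian-jet constant** `G₄ = R₄/ρ₀ + 4R₃Δ₁/ρ₀² + 6R₂Δ₂/ρ₀² + 12R₂Δ₁²/ρ₀³ + 4R₁Δ₃/ρ₀² + 24R₁Δ₁Δ₂/ρ₀³ + 24R₁Δ₁³/ρ₀⁴ +
π√2·(Δ₄/ρ₀² + 8Δ₁Δ₃/ρ₀³ + 6Δ₂²/ρ₀³ + 36Δ₁²Δ₂/ρ₀⁴ + 24Δ₁⁴/ρ₀⁵)`. -/
def klJacG4 (Dt A A₃ A₄ A₅ : ℝ) : ℝ :=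
  klJacR4 Dt A A₃ A₄ / (Dt - 2 * A) + 4 * (klJacR3 Dt A A₃ * klJacΔ1 Dt A) / (Dt - 2 * A) ^ 2 +
    6 * (klJacR2 Dt A * klJacΔ2 Dt A A₃) / (Dt - 2 * A) ^ 2 + 12 * (klJacR2 Dt A * klJacΔ1 Dt A ^ 2) / (Dt - 2 * A) ^ 3 +
    4 * (klJacR1 Dt A * klJacΔ3 Dt A A₃ A₄) / (Dt - 2 * A) ^ 2 + 24 * (klJacR1 Dt A * (klJacΔ1 Dt A * klJacΔ2 Dt A A₃)) / (Dt - 2 * A) ^ 3 +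
    24 * (klJacR1 Dt A * klJacΔ1 Dt A ^ 3) / (Dt - 2 * A) ^ 4 + π * Real.sqrt 2 * klJacΔ4 Dt A A₃ A₄ A₅ / (Dt - 2 * A) ^ 2 +
    8 * (π * Real.sqrt 2 * (klJacΔ1 Dt A * klJacΔ3 Dt A A₃ A₄)) / (Dt - 2 * A) ^ 3 + 6 * (π * Real.sqrt 2 * klJacΔ2 Dt A A₃ ^ 2) / (Dt - 2 * A) ^ 3 +
    36 * (π * Real.sqrt 2 * (klJacΔ1 Dt A ^ 2 * klJacΔ2 Dt A A₃)) / (Dt - 2 * A) ^ 4 + 24 * (π * Real.sqrt 2 * klJacΔ1 Dt A ^ 4) / (Dt - 2 * A) ^ 5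

/-- **The Jacobian-jet table to order 4**: orders `≤ 3` from `klJacGTable`, order `≥ 4` from `klJacG4`. -/
def klJacGTable4 (Dt A A₃ A₄ A₅ : ℝ) (i : ℕ) : ℝ :=
  if i ≤ 3 then klJacGTable Dt A A₃ A₄ i else klJacG4 Dt A A₃ A₄ A₅

section Frame

variable {a b : ℝ} (B : BandBounds a b) {K : TrigPolyC4v} {A : ℝ}
  (hA : ∀ p : Momentum, ∀ j ≤ 2, ‖iteratedFDeriv ℝ j (frameShift K) p‖ ≤ A) (hADt : 2 * A < B.Dtmin)
  {μ ρ : ℝ} (hlo : a < μ + ρ - A) (hhi : μ + ρ + A < b)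
include B hA hADt hlo hhi

/-- **Order 4 at the frame**: `|∂_ϑ⁴ levelChartJac μ K (ρ, ϑ)| ≤ klJacG4 B.Dtmin A A₃ A₄ A₅`. -/
theorem abs_deriv_four_levelChartJac_le {A₃ A₄ A₅ : ℝ} (hA₃ : ∀ p : Momentum, ‖iteratedFDeriv ℝ 3 (frameShift K) p‖ ≤ A₃)
    (hA₄ : ∀ p : Momentum, ‖iteratedFDeriv ℝ 4 (frameShift K) p‖ ≤ A₄)
    (hA₅ : ∀ p : Momentum, ‖iteratedFDeriv ℝ 5 (frameShift K) p‖ ≤ A₅) (ϑ : ℝ) :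
    |deriv (deriv (deriv (deriv (fun s : ℝ => levelChartJac μ K (ρ, s))))) ϑ| ≤ klJacG4 B.Dtmin A A₃ A₄ A₅ := by
  obtain ⟨-, hu, hρ, hE₁, hE₂, hU₀, hR₁, hR₂⟩ := polar_data B hA hADt hlo hhi
  obtain ⟨hC, hδ, hκ, hκ₂, hroot⟩ := frame_band_data B hA (μ := μ + ρ) hlo.le hhi.le
  have he5 : ContDiff ℝ 5 (fun k : Fin 2 → ℝ => sqDispersion k + (fun k : Fin 2 → ℝ => -K.eval k) k) :=
    contDiff_sqDispersion.add (by rw [← frameShift_toLp_eq_neg_eval]; exact contDiff_frameShift_toLp K)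
  have hκ₃ : ∀ k : Fin 2 → ℝ, (∀ i, |k i| ≤ π) →
      ‖fderiv ℝ (fderiv ℝ (fderiv ℝ (fun p : Fin 2 → ℝ => -K.eval p))) k‖ ≤ 8 * A₃ := fun k _ => norm_fderiv_three_frameShift_le hA₃ k
  have hκ₄ : ∀ k : Fin 2 → ℝ, (∀ i, |k i| ≤ π) →
      ‖fderiv ℝ (fderiv ℝ (fderiv ℝ (fderiv ℝ (fun p : Fin 2 → ℝ => -K.eval p)))) k‖ ≤ 16 * A₄ :=
    fun k _ => norm_fderiv_four_frameShift_le hA₄ k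
  have hE₃ : ∀ ϑ, ‖fderiv ℝ (fderiv ℝ (fderiv ℝ (fun k : Fin 2 → ℝ => sqDispersion k + (fun k : Fin 2 → ℝ => -K.eval k) k)))
      (perturbedFermiRadius (fun k : Fin 2 → ℝ => -K.eval k) (μ + ρ) ϑ • dir ϑ)‖ ≤ 4 + 8 * A₃ :=
    fun ϑ => norm_fderiv_three_pertBand_le hC hroot hκ₃ ϑ
  have hE₄ : ∀ ϑ, ‖fderiv ℝ (fderiv ℝ (fderiv ℝ (fderiv ℝ (fun k : Fin 2 → ℝ => sqDispersion k + (fun k : Fin 2 → ℝ => -K.eval k) k))))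
      (perturbedFermiRadius (fun k : Fin 2 → ℝ => -K.eval k) (μ + ρ) ϑ • dir ϑ)‖ ≤ 4 + 16 * A₄ :=
    fun ϑ => norm_fderiv_four_pertBand_le hC hroot hκ₄ ϑ
  have hE₅ : ∀ ϑ, ‖fderiv ℝ (fderiv ℝ (fderiv ℝ (fderiv ℝ (fderiv ℝ
      (fun k : Fin 2 → ℝ => sqDispersion k + (fun k : Fin 2 → ℝ => -K.eval k) k)))))
      (perturbedFermiRadius (fun k : Fin 2 → ℝ => -K.eval k) (μ + ρ) ϑ • dir ϑ)‖ ≤ 4 + 32 * A₅ :=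
    fun ϑ => norm_fderiv_five_pertBand_le hA₅ _
  have hR₃ : ∀ ϑ, |deriv (deriv (deriv (perturbedFermiRadius (fun k : Fin 2 → ℝ => -K.eval k) (μ + ρ)))) ϑ| ≤
      klJacR3 B.Dtmin A A₃ := fun ϑ =>
    abs_deriv_three_le_of_isRoot B hC hδ hlo.le hhi.le hκ hADt hroot hκ₂ hκ₃ (hR₁ ϑ) (hR₂ ϑ)
  have hR₄ : ∀ ϑ, |deriv (deriv (deriv (deriv (perturbedFermiRadius (fun k : Fin 2 → ℝ => -K.eval k) (μ + ρ))))) ϑ| ≤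
      klJacR4 B.Dtmin A A₃ A₄ := fun ϑ =>
    abs_deriv_four_le_of_isRoot B hC hδ hlo.le hhi.le hκ hADt hroot hκ₂ hκ₃ hκ₄ (hR₁ ϑ) (hR₂ ϑ) (hR₃ ϑ)
  rw [levelChartJac_curve_eq_polarJac B hA hADt hlo hhi]
  have h := abs_deriv_four_polarJac_le he5 hu (sub_pos.2 hADt) hρ hE₁ hE₂ hE₃ hE₄ hE₅ hU₀ hR₁ hR₂ hR₃ hR₄ ϑ
  simpa [klJacG4, klJacΔ1, klJacΔ2, klJacΔ3, klJacΔ4, mul_div_assoc] using h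

/-- **Jacobian jets of orders `≤ 4` on the tube** (the `hJjet` of `norm_iteratedDeriv_tubeTadpole_le` at `N = 4`):
`∀ i ≤ 4, ∀ s, ‖iteratedDeriv i (fun s => levelChartJac μ K (ρ, s)) s‖ ≤ klJacGTable4 B.Dtmin A A₃ A₄ A₅ i`. -/
theorem norm_iteratedDeriv_levelChartJac_le_four {A₃ A₄ A₅ : ℝ} (hA₃ : ∀ p : Momentum, ‖iteratedFDeriv ℝ 3 (frameShift K) p‖ ≤ A₃)
    (hA₄ : ∀ p : Momentum, ‖iteratedFDeriv ℝ 4 (frameShift K) p‖ ≤ A₄)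
    (hA₅ : ∀ p : Momentum, ‖iteratedFDeriv ℝ 5 (frameShift K) p‖ ≤ A₅) {i : ℕ} (hi : i ≤ 4) (s : ℝ) :
    ‖iteratedDeriv i (fun s : ℝ => levelChartJac μ K (ρ, s)) s‖ ≤ klJacGTable4 B.Dtmin A A₃ A₄ A₅ i := by
  by_cases h3 : i ≤ 3
  · rw [klJacGTable4, if_pos h3]
    exact norm_iteratedDeriv_levelChartJac_le_three B hA hADt hlo hhi hA₃ hA₄ h3 s
  · have hi4 : i = 4 := by omega
    subst hi4
    rw [klJacGTable4, if_neg h3, Real.norm_eq_abs, iteratedDeriv_succ, iteratedDeriv_succ, iteratedDeriv_succ, iteratedDeriv_one]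
    exact abs_deriv_four_levelChartJac_le B hA hADt hlo hhi hA₃ hA₄ hA₅ s

end Frame

end Summit.HubbardSuperconductivity.HubbardSuperconductivity.Theorems.C4a
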